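import Literature.Analysis.FluidPDE.SerrinEnstrophyGronwall
import Literature.Analysis.FluidPDE.EnstrophyGronwall

/-!
# Crux `Target` = `TypeICertificateLadder.NoTypeIBlowup` (stmt-NavierStokesRegularity-1217), negative side:
# the SHARP endpoint enstrophy inequality `∫|∇u(s)|² ≤ exp((2ν)⁻¹ ∫₀ˢ ‖u‖²_∞) ∫|∇u(0)|²`

Negative-side (cdisprove gen 4, D-0016) support lemma, importable (`--supports` stmt-1217), for the
explicit Type-I constant of a counterexample (`ExplicitTypeIConstant.lean`): on a Tao-class slab
`[0, T] × ℝ³` (classical solution of the unforced system with all `L²` Sobolev norms of `u`, `∂ₜu`,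
`p` bounded) the enstrophy obeys, for `0 < s ≤ T`,
`∫|∇u(s)|² ≤ exp((2ν)⁻¹ ∫₀ˢ ‖u(t)‖²_{L^∞} dt) ∫|∇u(0)|²`
(`lintegral_frobeniusNormSq_le_exp_half_linfty`). This is the time-dependent form of the tree's
`lintegral_frobeniusNormSq_fderiv_le_mul_exp` (constant bound `M`, factor `exp(M² s/(2ν))`,
Lemarié-Rieusset 2016 Thm. 11.2 (11.11) at `q = ∞`) and the sharp-constant form of
`serrin_enstrophy_le_mul_exp` at `θ = 1` (whose generic interpolation constant evaluates to `ν⁻¹`):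
the proof is that of `serrin_enstrophy_le_mul_exp` — enstrophy balance
(`IsSmoothSpaceTimeOn.enstrophy_balance`) and Grönwall in `ℝ≥0∞` (`lintegral_gronwall_le`) — with the
slice production bounded by the sharp `L^∞` lemma `integral_sum_inner_fderiv_le_of_momentum`
(`∫ Σᵢ⟪∂ᵢu, ∂ᵢ∂ₜu⟫ ≤ (‖u(t)‖²_∞/(4ν)) ∫|∇u(t)|²`) at `M = ‖u(t)‖_{L^∞}`. The factor `2` is exactly
what separates the dimensionless rungs `C < 1/√2` from `C < 1`.
[cite: LemarieRieusset2016, Thm. 11.2 (11.11)] [cite: RobinsonRodrigoSadowski2016, Lemma 8.16 (proof)]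
-/

noncomputable section

open MeasureTheory TopologicalSpace Set Function Filter Metric
open scoped Topology RealInnerProductSpace ENNReal NNReal Laplacian
open Literature.Analysis.FluidPDE

namespace Summit.NavierStokesRegularity.NavierStokesRegularity.Theorems.Target.Negative

set_option linter.dupNamespace false

/-- **The sharp endpoint enstrophy inequality on a Tao-class slab** (Lemarié-Rieusset 2016,
Thm. 11.2, (11.11) with `q = ∞`, sharp Young constant): for a classical solution of the unforced
Navier–Stokes system with viscosity `ν > 0` on `[0, T] × ℝ³` with `u`, `∂ₜu`, `p` in Tao's
`L²`-Sobolev class, and `0 < s ≤ T` with `∫₀ˢ ‖u(t)‖²_∞ dt < ∞`,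
`∫ |∇u(s)|² ≤ exp((2ν)⁻¹ ∫₀ˢ ‖u(t)‖²_{L^∞} dt) ∫ |∇u(0)|²`. -/
theorem lintegral_frobeniusNormSq_le_exp_half_linfty {ν T : ℝ} (hν : 0 < ν) (hT : 0 < T)
    {u : ℝ → EuclideanSpace ℝ (Fin 3) → EuclideanSpace ℝ (Fin 3)}
    {p : ℝ → EuclideanSpace ℝ (Fin 3) → ℝ} (hsol : IsClassicalNSSolutionOn (Icc 0 T) ν 0 u p)
    (hu : HasBoundedSobolevNormsOn (Icc 0 T) u)
    (hut : HasBoundedSobolevNormsOn (Icc 0 T) (timeDerivWithin (Icc 0 T) u))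
    (hp : ∀ n : ℕ, ∃ C : ℝ≥0, ∀ t ∈ Icc 0 T, ∫⁻ x, ‖iteratedFDeriv ℝ n (p t) x‖ₑ ^ 2 ≤ C)
    {s : ℝ} (hs : s ∈ Ioc 0 T)
    (hA : ∫⁻ t in Ioo 0 s, ENNReal.ofReal ((eLpNorm (u t) ⊤ volume).toReal ^ (2 : ℝ)) ≠ ⊤) :
    ∫⁻ x, ENNReal.ofReal (frobeniusNormSq (fderiv ℝ (u s) x)) ≤
      ENNReal.ofReal (Real.exp ((2 * ν)⁻¹ *
          (∫⁻ t in Ioo 0 s, ENNReal.ofReal ((eLpNorm (u t) ⊤ volume).toReal ^ (2 : ℝ))).toReal)) *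
        ∫⁻ x, ENNReal.ofReal (frobeniusNormSq (fderiv ℝ (u 0) x)) := by
  set e := EuclideanSpace.basisFun (Fin 3) ℝ with he
  have hU : UniqueDiffOn ℝ (Icc 0 T) := uniqueDiffOn_Icc hT
  set W : ℝ → EuclideanSpace ℝ (Fin 3) → EuclideanSpace ℝ (Fin 3) :=
    timeDerivWithin (Icc 0 T) u with hW
  have hWsm : IsSmoothSpaceTimeOn (Icc 0 T) W := hsol.smooth_velocity.timeDerivWithin hU
  -- a pointwise bound on `u` over the slab (Sobolev), so that each slice is in `L^∞`
  obtain ⟨B₀, hB₀⟩ := linfty_bound_of_hasBoundedSobolevNormsOn_holds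
    (fun t ht => (hsol.contDiff_velocity ht).of_le (by norm_cast)) hu
  obtain ⟨C₁, hC₁⟩ := hu 1
  obtain ⟨D₂, hD₂⟩ := hu 2
  obtain ⟨E₀, hE₀⟩ := hut 0
  obtain ⟨E₁, hE₁⟩ := hut 1
  obtain ⟨P₀, hP₀⟩ := hp 0
  obtain ⟨P₁, hP₁⟩ := hp 1
  have hzero : ∀ {f : EuclideanSpace ℝ (Fin 3) → EuclideanSpace ℝ (Fin 3)} {C' : ℝ≥0},
      (∫⁻ x, ‖iteratedFDeriv ℝ 0 f x‖ₑ ^ 2 ≤ C') → ∫⁻ x, ‖f x‖ₑ ^ 2 < ⊤ := by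
    intro f C' h
    refine lt_of_le_of_lt ((le_of_eq (lintegral_congr fun x => ?_)).trans h) ENNReal.coe_lt_top
    rw [← ofReal_norm, ← ofReal_norm, norm_iteratedFDeriv_zero]
  have hzero' : ∀ {f : EuclideanSpace ℝ (Fin 3) → ℝ} {C' : ℝ≥0},
      (∫⁻ x, ‖iteratedFDeriv ℝ 0 f x‖ₑ ^ 2 ≤ C') → ∫⁻ x, ‖f x‖ₑ ^ 2 < ⊤ := by
    intro f C' h
    refine lt_of_le_of_lt ((le_of_eq (lintegral_congr fun x => ?_)).trans h) ENNReal.coe_lt_top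
    rw [← ofReal_norm, ← ofReal_norm, norm_iteratedFDeriv_zero]
  -- slice sup norms: finite, and pointwise bounds
  have hLtop : ∀ t ∈ Icc 0 T, eLpNorm (u t) ⊤ volume < ⊤ := by
    intro t ht
    rw [eLpNorm_exponent_top]
    exact (eLpNormEssSup_le_of_ae_bound (Eventually.of_forall (hB₀ t ht))).trans_lt ENNReal.ofReal_lt_top
  set N : ℝ → ℝ := fun t => (eLpNorm (u t) ⊤ volume).toReal with hN
  have hN0 : ∀ t, 0 ≤ N t := fun t => ENNReal.toReal_nonneg
  have hNpt : ∀ t ∈ Icc 0 T, ∀ x, ‖u t x‖ ≤ N t := fun t ht x =>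
    norm_le_toReal_eLpNorm_top_of_continuous (hsol.contDiff_velocity ht).continuous (hLtop t ht) x
  -- the enstrophy balance
  obtain ⟨hΦint, hGcont, hGb⟩ := hsol.smooth_velocity.enstrophy_balance hT hC₁ hE₁
  set Φ : ℝ → ℝ := fun t => ∫ x, 2 * ∑ i, ⟪fderiv ℝ (u t) x (e i), fderiv ℝ (W t) x (e i)⟫ with hΦ
  set G : ℝ → ℝ := fun t => ∫ x, frobeniusNormSq (fderiv ℝ (u t) x) with hG
  have hG0 : ∀ t, 0 ≤ G t := fun t => integral_nonneg fun x => frobeniusNormSq_nonneg _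
  have hfrob_le : ∀ t ∈ Icc 0 T,
      ∫⁻ x, ENNReal.ofReal (frobeniusNormSq (fderiv ℝ (u t) x)) ≤ 3 * C₁ := by
    intro t ht
    calc ∫⁻ x, ENNReal.ofReal (frobeniusNormSq (fderiv ℝ (u t) x))
        ≤ ∫⁻ x, 3 * ‖iteratedFDeriv ℝ 1 (u t) x‖ₑ ^ 2 := lintegral_mono fun x => by
          rw [← ofReal_norm, norm_iteratedFDeriv_one, ofReal_norm]
          exact ofReal_frobeniusNormSq_le_three_mul_enorm_sq _
      _ = 3 * ∫⁻ x, ‖iteratedFDeriv ℝ 1 (u t) x‖ₑ ^ 2 := lintegral_const_mul' _ _ (by norm_num)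
      _ ≤ 3 * C₁ := by gcongr; exact hC₁ t ht
  have hfrob_lt : ∀ t ∈ Icc 0 T,
      ∫⁻ x, ENNReal.ofReal (frobeniusNormSq (fderiv ℝ (u t) x)) < ⊤ := fun t ht =>
    lt_of_le_of_lt (hfrob_le t ht) (ENNReal.mul_lt_top (by norm_num) ENNReal.coe_lt_top)
  have ifrob : ∀ t ∈ Icc 0 T, Integrable (fun x => frobeniusNormSq (fderiv ℝ (u t) x)) volume :=
    fun t ht => integrable_of_continuous_of_nonneg
      (continuous_frobeniusNormSq_fderiv (hsol.contDiff_velocity ht) (by simp))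
      (fun x => frobeniusNormSq_nonneg _) (hfrob_lt t ht)
  have hGeq : ∀ t ∈ Icc 0 T, ENNReal.ofReal (G t) =
      ∫⁻ x, ENNReal.ofReal (frobeniusNormSq (fderiv ℝ (u t) x)) := fun t ht =>
    ofReal_integral_eq_lintegral_ofReal (ifrob t ht)
      (Eventually.of_forall fun x => frobeniusNormSq_nonneg _)
  -- the SHARP production bound at interior times: `Φ t ≤ (N t)²/(2ν) * G t`
  set Nq : ℝ → ℝ := fun t => N t ^ (2 : ℝ) with hNq
  have hNq0 : ∀ t, 0 ≤ Nq t := fun t => Real.rpow_nonneg (hN0 t) _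
  have hslice : ∀ t ∈ Ioo 0 T, Φ t ≤ (2 * ν)⁻¹ * Nq t * G t := by
    intro t ht
    have htI : t ∈ Icc 0 T := Ioo_subset_Icc_self ht
    have hmom : ∀ x, W t x + convect (u t) (u t) x = ν • (Δ (u t)) x - gradient (p t) x := by
      intro x
      have h := hsol.momentum t htI x
      simpa [hW] using h
    have hsl := integral_sum_inner_fderiv_le_of_momentum hν
      ((hsol.contDiff_velocity htI).of_le (by norm_cast))
      ((hWsm.contDiff_slice htI).of_le (by norm_cast))
      ((hsol.contDiff_pressure htI).of_le (by norm_cast)) hmom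
      (isDivFree_timeDerivWithin hsol.smooth_velocity hsol.divFree ht) (hN0 t) (hNpt t htI)
      (hfrob_lt t htI) ((hD₂ t htI).trans_lt ENNReal.coe_lt_top)
      (hzero (hE₀ t htI)) ((hE₁ t htI).trans_lt ENNReal.coe_lt_top)
      (hzero' (hP₀ t htI)) ((hP₁ t htI).trans_lt ENNReal.coe_lt_top)
    have h2 : Φ t = 2 * ∫ x, ∑ i, ⟪fderiv ℝ (u t) x (e i), fderiv ℝ (W t) x (e i)⟫ := by
      rw [hΦ]
      exact integral_const_mul _ _
    rw [h2]
    have := mul_le_mul_of_nonneg_left hsl (zero_le_two (α := ℝ))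
    refine this.trans_eq ?_
    simp only [hNq, hG, Real.rpow_two]
    field_simp
    ring
  -- Grönwall in `ℝ≥0∞`
  set φE : ℝ → ℝ≥0∞ := fun t => ENNReal.ofReal (G t) with hφE
  set κ : ℝ := (2 * ν)⁻¹ with hκ
  have hκ0 : 0 ≤ κ := by positivity
  set aE : ℝ → ℝ≥0∞ := fun t => ENNReal.ofReal κ * ENNReal.ofReal (Nq t) with haE
  have hM : ∀ t ∈ Icc 0 s, φE t ≤ 3 * C₁ := fun t ht => by
    rw [hφE]; simp only; rw [hGeq t ⟨ht.1, ht.2.trans hs.2⟩]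
    exact hfrob_le t ⟨ht.1, ht.2.trans hs.2⟩
  have haS : ∫⁻ t in Ioo 0 s, aE t ≠ ⊤ := by
    rw [haE]; simp only
    rw [lintegral_const_mul' _ _ ENNReal.ofReal_ne_top]
    exact ENNReal.mul_ne_top ENNReal.ofReal_ne_top hA
  have hineq : ∀ t ∈ Icc 0 s, φE t ≤ φE 0 + ∫⁻ τ in Ioo 0 t, aE τ * φE τ := by
    intro t ht
    rcases eq_or_lt_of_le ht.1 with h0 | ht0
    · rw [← h0]; simp
    have htT : t ∈ Ioc 0 T := ⟨ht0, ht.2.trans hs.2⟩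
    have hΦt : IntegrableOn Φ (Ioo 0 t) volume := hΦint.mono_set (Ioo_subset_Ioo le_rfl htT.2)
    have h1 : ENNReal.ofReal (∫ τ in Ioo 0 t, Φ τ) ≤ ∫⁻ τ in Ioo 0 t, ENNReal.ofReal (Φ τ) := by
      calc ENNReal.ofReal (∫ τ in Ioo 0 t, Φ τ) ≤ ENNReal.ofReal (∫ τ in Ioo 0 t, max (Φ τ) 0) :=
            ENNReal.ofReal_le_ofReal (integral_mono hΦt hΦt.pos_part fun τ => le_max_left _ _)
        _ = ∫⁻ τ in Ioo 0 t, ENNReal.ofReal (max (Φ τ) 0) :=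
            ofReal_integral_eq_lintegral_ofReal hΦt.pos_part (Eventually.of_forall fun τ => le_max_right _ _)
        _ = ∫⁻ τ in Ioo 0 t, ENNReal.ofReal (Φ τ) := lintegral_congr fun τ => by
            rcases le_total (Φ τ) 0 with h | h
            · rw [max_eq_right h, ENNReal.ofReal_zero, ENNReal.ofReal_of_nonpos h]
            · rw [max_eq_left h]
    have h2 : ∫⁻ τ in Ioo 0 t, ENNReal.ofReal (Φ τ) ≤ ∫⁻ τ in Ioo 0 t, aE τ * φE τ := by
      refine setLIntegral_mono' measurableSet_Ioo fun τ hτ => ?_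
      have hτT : τ ∈ Ioo 0 T := ⟨hτ.1, hτ.2.trans_le htT.2⟩
      calc ENNReal.ofReal (Φ τ) ≤ ENNReal.ofReal (κ * Nq τ * G τ) :=
            ENNReal.ofReal_le_ofReal (by simpa [hκ, mul_assoc] using hslice τ hτT)
        _ = aE τ * φE τ := by
            rw [haE, hφE]; simp only
            rw [ENNReal.ofReal_mul (mul_nonneg hκ0 (hNq0 τ)), ENNReal.ofReal_mul hκ0]
    calc φE t = ENNReal.ofReal (G 0 + ∫ τ in (0 : ℝ)..t, Φ τ) := by
          rw [hφE]; simp only; congr 1; exact hGb t htT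
      _ ≤ ENNReal.ofReal (G 0) + ENNReal.ofReal (∫ τ in (0 : ℝ)..t, Φ τ) := ENNReal.ofReal_add_le
      _ = φE 0 + ENNReal.ofReal (∫ τ in Ioo 0 t, Φ τ) := by
          rw [intervalIntegral.integral_of_le ht.1, integral_Ioc_eq_integral_Ioo]
      _ ≤ φE 0 + ∫⁻ τ in Ioo 0 t, aE τ * φE τ := by gcongr; exact h1.trans h2
  have hgron := lintegral_gronwall_le (S := s) ENNReal.ofReal_ne_top
    (ENNReal.mul_ne_top (by norm_num) ENNReal.coe_ne_top) hM haS hineq s ⟨hs.1.le, le_rfl⟩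
  -- unpack
  have hint_a : (∫⁻ τ in Ioo 0 s, aE τ).toReal =
      κ * (∫⁻ t in Ioo 0 s, ENNReal.ofReal (Nq t)).toReal := by
    rw [haE]; simp only
    rw [lintegral_const_mul' _ _ ENNReal.ofReal_ne_top, ENNReal.toReal_mul, ENNReal.toReal_ofReal hκ0]
  rw [hint_a] at hgron
  rw [← hGeq s ⟨hs.1.le, hs.2⟩, ← hGeq 0 ⟨le_rfl, hT.le⟩, mul_comm]
  convert hgron using 3

end Summit.NavierStokesRegularity.NavierStokesRegularity.Theorems.Target.Negative

end
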